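import Summits.Schanuel.Schanuel.Theorems.RootDecomp1KHyper36

/-!
# RootDecomp1KHyper — lens 6, generation 15 ADDENDA «EXP-LATTICE-ANCHORED CELL» (ExpAnchorT.lean v2 88910796…) and «NESTERENKO-ANCHORED CELL» (PiAnchorT.lean b5ead9a0…, §7) — continuation (RootDecomp1KHyper37): §7d–§7f (PiAnchorT.lean ll. 2589–2876): the cell `HasPiIntAnchor` (span ∋ N₁, N₂·π; `.mono`, `_congr_span`), MAIN `sb_three_of_piIntAnchor` (mod h52, hNW), carve `rank3SpanResidual_iff_piUnanchored`, literal cell `sb_three_one_pi_any`, ONE algebraic line `eq_intCast_of_isAlgebraic_mem_span_one_pi_sub`, member z_π = (1, π − 3, y(π − 3)) (`ternarySmallForms_zπ`, `linearIndependent_zπ`, `sb_three_zπ`, `rank3SpanResidual_instance_zπ`), combined carve `rank3SpanResidual_iff_unanchored₃`, `placement_zπ`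

(lens-6 g15 addenda: `ExpAnchorT.lean` v2 88910796…cc8b = parts 28–35, `PiAnchorT.lean` b5ead9a0…03de §7 (ll. 2343–2876; parts A–H byte-identical to ExpAnchorT) = parts 36–37; farm rc 0 · 0 sorry · axioms std; port by census-1 gen 14,
CENSUS-REQUESTs STATUS L1561 / L1583, critic PORT GO L1568 (e) / L1588 (e); import `RootDecomp1KHyper26` (+ `Literature.Barriers.Schanuel.NesterenkoModularScopeMeasurePi`, `Literature.NumberTheory.Transcendental.PiTranscendenceMeasure` from part 36 on), the source's g15 plane-lemma copy dropped,
sub-namespace `…HyperCell.LatCell`; statements and proofs verbatim (docstrings added, generic one-liners privatised, the two lint fixes of L1588 (a) in §7c); `hLW : LWMeasure`, `h52`, `hNW` (tree-named facts) stay binders; `--supports stmt-Schanuel-33363` (residual of record n = 3 := UnanchoredResidual₃″). Nothing here proves Schanuel; rung 0.)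
-/

noncomputable section

open Complex IntermediateField Polynomial

namespace Summit.Schanuel.Schanuel.Theorems.RootDecomp1KHyper

namespace HyperCell

namespace LatCell

variable {n : ℕ}
open Summit.Schanuel.Schanuel.Theorems.RootDecomp1KGeneric (HasHLPairInSpan Rank3SpanResidual
  mem_adjoin_of_mem_span cexp_mem_adjoin_of_mem_span)

/-! ### §7d  The cell `HasPiIntAnchor`, the MAIN THEOREM, the carve, the literal cell `(1, π, y)` -/

/-- **`HasPiIntAnchor z`** (the Nesterenko-anchored cell) — the ℤ-span of the tuple contains a
non-zero INTEGER and `π`.  A property of the lattice `span_ℤ(z)` only (re-basing-invariant,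
padding-monotone); no Lindemann–Weierstrass anchor is visible in such a span (`π` is in no LW field
that anyone can exhibit), so this cell lies in the critic's class M2. -/
def HasPiIntAnchor {N : ℕ} (z : Fin N → ℂ) : Prop :=
  ∃ N₁ : ℤ, N₁ ≠ 0 ∧ ((N₁ : ℂ)) ∈ Submodule.span ℤ (Set.range z) ∧
    (Real.pi : ℂ) ∈ Submodule.span ℤ (Set.range z)

/-- `HasPiIntAnchor` is monotone along inclusions of `ℤ`-spans (re-basing invariant, padding-monotone). -/
theorem HasPiIntAnchor.mono {N N' : ℕ} {z : Fin N → ℂ} {z' : Fin N' → ℂ}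
    (hle : Submodule.span ℤ (Set.range z) ≤ Submodule.span ℤ (Set.range z'))
    (h : HasPiIntAnchor z) : HasPiIntAnchor z' := by
  obtain ⟨N₁, h1, hm1, hm2⟩ := h
  exact ⟨N₁, h1, hle hm1, hle hm2⟩

/-- `HasPiIntAnchor` depends only on the `ℤ`-span of the tuple. -/
theorem hasPiIntAnchor_congr_span {N N' : ℕ} {z : Fin N → ℂ} {z' : Fin N' → ℂ}
    (heq : Submodule.span ℤ (Set.range z) = Submodule.span ℤ (Set.range z')) :
    HasPiIntAnchor z ↔ HasPiIntAnchor z' :=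
  ⟨HasPiIntAnchor.mono heq.le, HasPiIntAnchor.mono heq.ge⟩

/-- **MAIN THEOREM OF §7 (mod LNM 1752 Ch. 3 Cor. 5.2 and NW 1996 Thm 2(2); NO Lindemann–Weierstrass
input).**  A ℚ-free `HyperLinLiouville` triple whose ℤ-span contains a non-zero integer and `π` has
Schanuel's bound `trdeg ℚ(z, e^z) ≥ 3`.  (Measured pair `θ_π = (e^{π}, π)`, lattice polynomials
`W₁ = N₁`, `W₂ = X₁`; some coordinate `z_j` is then hyper-approximable from `(ℤ N₁ + ℤ π)/E` and
`(z_j, e^{π}, π)` is algebraically independent inside `ℚ(z, e^z, i)`.) -/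
theorem sb_three_of_piIntAnchor
    (h52 : Literature.Barriers.Schanuel.NesterenkoPhilippon2001_ch3_cor_5_2)
    (hNW : Literature.NumberTheory.Transcendental.NesterenkoWaldschmidt1996_thm_2_2)
    {z : Fin 3 → ℂ} (hz : LinearIndependent ℚ z) (hH : HyperLinLiouville z)
    (hA : HasPiIntAnchor z) : SB 3 z := by
  obtain ⟨N₁, hN₁, h₁, h₂⟩ := hA
  have hθz : ∀ i, θπ i ∈ adjoin ℚ (SFset z ∪ {I}) := by
    intro i
    match i with
    | 0 => exact cexp_mem_adjoin_of_mem_span h₂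
    | 1 => exact mem_adjoin_of_mem_span h₂
  exact sb_three_of_latAnchorW hz hH (mvWeakMeasure_θπ h52) hθz (MvPolynomial.C N₁)
    (MvPolynomial.X 1) (by simp) (by simp) (latLB_int_pi hNW hN₁) h₁ h₂

/-- **The residual SPLIT along the Nesterenko-anchored cell.** -/
theorem rank3SpanResidual_iff_piUnanchored
    (h52 : Literature.Barriers.Schanuel.NesterenkoPhilippon2001_ch3_cor_5_2)
    (hNW : Literature.NumberTheory.Transcendental.NesterenkoWaldschmidt1996_thm_2_2) :
    Rank3SpanResidual ↔
      ∀ z : Fin 3 → ℂ, LinearIndependent ℚ z → HyperLinLiouville z →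
        ¬ HasHLPairInSpan z → ¬ HasPiIntAnchor z → SB 3 z :=
  rank3SpanResidual_iff_of_cell fun _ hz hH hA => sb_three_of_piIntAnchor h52 hNW hz hH hA

/-- Three-cell carve helper. -/
theorem rank3SpanResidual_iff_of_cells₃ {Q₁ Q₂ Q₃ : (Fin 3 → ℂ) → Prop}
    (hQ₁ : ∀ z : Fin 3 → ℂ, LinearIndependent ℚ z → HyperLinLiouville z → Q₁ z → SB 3 z)
    (hQ₂ : ∀ z : Fin 3 → ℂ, LinearIndependent ℚ z → HyperLinLiouville z → Q₂ z → SB 3 z)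
    (hQ₃ : ∀ z : Fin 3 → ℂ, LinearIndependent ℚ z → HyperLinLiouville z → Q₃ z → SB 3 z) :
    Rank3SpanResidual ↔
      ∀ z : Fin 3 → ℂ, LinearIndependent ℚ z → HyperLinLiouville z →
        ¬ HasHLPairInSpan z → ¬ Q₁ z → ¬ Q₂ z → ¬ Q₃ z → SB 3 z :=
  ⟨fun hR z hz hH hp _ _ _ => hR z hz hH hp, fun hR z hz hH hp => by
    by_cases h1 : Q₁ z
    · exact hQ₁ z hz hH h1
    · by_cases h2 : Q₂ z
      · exact hQ₂ z hz hH h2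
      · by_cases h3 : Q₃ z
        · exact hQ₃ z hz hH h3
        · exact hR z hz hH hp h1 h2 h3⟩

/-- `(1, π, y)` carries the Nesterenko anchor (`N₁ = 1`), for ANY `y`. -/
theorem hasPiIntAnchor_latTriple_one_pi (y : ℂ) : HasPiIntAnchor (latTriple 1 (Real.pi : ℂ) y) := by
  refine ⟨1, one_ne_zero, ?_, ?_⟩
  · simpa using Submodule.subset_span (R := ℤ) (s := Set.range (latTriple 1 (Real.pi : ℂ) y))
      ⟨0, rfl⟩
  · simpa using Submodule.subset_span (R := ℤ) (s := Set.range (latTriple 1 (Real.pi : ℂ) y))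
      ⟨1, rfl⟩

/-- **THE LITERAL M2 CELL `(1, π, y)`, ANY `y` (mod Cor. 5.2 + NW Thm 2(2)).**  Every ℚ-free
`HyperLinLiouville` triple `(1, π, y)` has Schanuel's bound `trdeg ℚ(1, π, y, e, e^{π}, e^{y}) ≥ 3` —
the critic's example shape `(1, x, y)`, `x ∉ ℚ̄`, at `x = π`. -/
theorem sb_three_one_pi_any
    (h52 : Literature.Barriers.Schanuel.NesterenkoPhilippon2001_ch3_cor_5_2)
    (hNW : Literature.NumberTheory.Transcendental.NesterenkoWaldschmidt1996_thm_2_2) {y : ℂ}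
    (hz : LinearIndependent ℚ (latTriple 1 (Real.pi : ℂ) y))
    (hH : HyperLinLiouville (latTriple 1 (Real.pi : ℂ) y)) : SB 3 (latTriple 1 (Real.pi : ℂ) y) :=
  sb_three_of_piIntAnchor h52 hNW hz hH (hasPiIntAnchor_latTriple_one_pi y)

/-! ### §7e  ONE algebraic line: the algebraic numbers in `span_ℤ(1, π − k, y)` are the integers
(mod Cor. 5.2 only) — such triples are OUTSIDE the g15 cell and ℚ-free -/

/-- `(y, e^{π}, π)` is algebraically independent for `y` hyper-approximable from `(ℤ + ℤ(π − k))/E`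
(mod Cor. 5.2). -/
theorem algebraicIndependent_one_pi_sub (h52 : Literature.Barriers.Schanuel.NesterenkoPhilippon2001_ch3_cor_5_2)
    (k : ℤ) {y : ℂ} (hy : HyperLatApprox 1 ((Real.pi : ℂ) - k) y) :
    AlgebraicIndependent ℚ (fun o : Option (Fin 2) => o.elim y θπ) := by
  have e₁ : MvPolynomial.aeval θπ (MvPolynomial.C 1 : MvPolynomial (Fin 2) ℤ) = 1 := by simp
  have e₂ : MvPolynomial.aeval θπ (MvPolynomial.X 1 - MvPolynomial.C k : MvPolynomial (Fin 2) ℤ) =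
      (Real.pi : ℂ) - k := by simp
  have hy' : HyperLatApprox (MvPolynomial.aeval θπ (MvPolynomial.C 1 : MvPolynomial (Fin 2) ℤ))
      (MvPolynomial.aeval θπ (MvPolynomial.X 1 - MvPolynomial.C k : MvPolynomial (Fin 2) ℤ)) y := by
    rw [e₁, e₂]; exact hy
  exact algebraicIndependent_option_θπ h52 _ _ hy'

/-- **ONE ALGEBRAIC LINE (mod Cor. 5.2): the algebraic numbers in `span_ℤ(1, π − k, y)` are exactly
the integers** (`y` hyper-approximable from `ℤ + ℤ(π − k)`). -/
theorem eq_intCast_of_isAlgebraic_mem_span_one_pi_sub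
    (h52 : Literature.Barriers.Schanuel.NesterenkoPhilippon2001_ch3_cor_5_2) (k : ℤ) {y : ℂ}
    (hy : HyperLatApprox 1 ((Real.pi : ℂ) - k) y) {v : ℂ}
    (hv : v ∈ Submodule.span ℤ (Set.range (latTriple 1 ((Real.pi : ℂ) - k) y)))
    (halg : IsAlgebraic ℚ v) : ∃ a : ℤ, v = a := by
  obtain ⟨c, hc⟩ := (Submodule.mem_span_range_iff_exists_fun ℤ).mp hv
  rw [Fin.sum_univ_three] at hc
  simp only [latTriple_zero, latTriple_one, latTriple_two, zsmul_eq_mul, mul_one] at hc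
  by_cases hbc : c 1 = 0 ∧ c 2 = 0
  · refine ⟨c 0, ?_⟩
    rw [← hc, hbc.1, hbc.2]; simp
  · exfalso
    have hbc' : c 1 ≠ 0 ∨ c 2 ≠ 0 := by
      by_contra hn; push Not at hn; exact hbc ⟨by tauto, by tauto⟩
    have h := not_isAlgebraic_affine (algebraicIndependent_one_pi_sub h52 k hy) θπ_one
      (a := c 0 - k * c 1) (b := c 1) (c := c 2) hbc'
    have e : ((c 0 - k * c 1 : ℤ) : ℂ) + (c 1 : ℂ) * (Real.pi : ℂ) + (c 2 : ℂ) * y = v := by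
      rw [← hc]; push_cast; ring
    rw [e] at h
    exact h halg

/-- **ℚ-freeness of `(1, π − k, y)` from algebraic independence (mod Cor. 5.2).** -/
theorem linearIndependent_one_pi_sub (h52 : Literature.Barriers.Schanuel.NesterenkoPhilippon2001_ch3_cor_5_2)
    (k : ℤ) {y : ℂ} (hy : HyperLatApprox 1 ((Real.pi : ℂ) - k) y) :
    LinearIndependent ℚ (latTriple 1 ((Real.pi : ℂ) - k) y) := by
  rw [← LinearIndependent.iff_fractionRing ℤ ℚ, Fintype.linearIndependent_iff]
  intro g hg
  rw [Fin.sum_univ_three] at hg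
  simp only [latTriple_zero, latTriple_one, latTriple_two, zsmul_eq_mul, mul_one] at hg
  have hF := algebraicIndependent_one_pi_sub h52 k hy
  have h12 : g 1 = 0 ∧ g 2 = 0 := by
    by_contra hn
    have hbc' : g 1 ≠ 0 ∨ g 2 ≠ 0 := by
      by_contra hn'; push Not at hn'; exact hn ⟨by tauto, by tauto⟩
    have h := not_isAlgebraic_affine hF θπ_one (a := g 0 - k * g 1) (b := g 1) (c := g 2) hbc'
    have e : ((g 0 - k * g 1 : ℤ) : ℂ) + (g 1 : ℂ) * (Real.pi : ℂ) + (g 2 : ℂ) * y = 0 := by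
      rw [← hg]; push_cast; ring
    rw [e] at h
    exact h isAlgebraic_zero
  have h0 : g 0 = 0 := by
    rw [h12.1, h12.2] at hg
    simp only [Int.cast_zero, zero_mul, add_zero] at hg
    exact_mod_cast hg
  intro i
  match i with
  | 0 => exact h0
  | 1 => exact h12.1
  | 2 => exact h12.2

/-- **Schanuel's bound for `(1, π − k, y)`, `y` hyper-approximable from `ℤ + ℤ(π − k)` (mod Cor. 5.2
ONLY)** — the engine applied directly to the given coordinate, no extraction needed. -/
theorem sb_three_latTriple_one_pi_sub
    (h52 : Literature.Barriers.Schanuel.NesterenkoPhilippon2001_ch3_cor_5_2) (k : ℤ) {y : ℂ}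
    (hy : HyperLatApprox 1 ((Real.pi : ℂ) - k) y) : SB 3 (latTriple 1 ((Real.pi : ℂ) - k) y) := by
  have e₁ : MvPolynomial.aeval θπ (MvPolynomial.C 1 : MvPolynomial (Fin 2) ℤ) = 1 := by simp
  have e₂ : MvPolynomial.aeval θπ (MvPolynomial.X 1 - MvPolynomial.C k : MvPolynomial (Fin 2) ℤ) =
      (Real.pi : ℂ) - k := by simp
  have hy' : HyperLatApprox (MvPolynomial.aeval θπ (MvPolynomial.C 1 : MvPolynomial (Fin 2) ℤ))
      (MvPolynomial.aeval θπ (MvPolynomial.X 1 - MvPolynomial.C k : MvPolynomial (Fin 2) ℤ)) y := by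
    rw [e₁, e₂]; exact hy
  have hπ : (Real.pi : ℂ) ∈ Submodule.span ℤ (Set.range (latTriple 1 ((Real.pi : ℂ) - k) y)) := by
    have hm : latTriple 1 ((Real.pi : ℂ) - k) y 1 + k • latTriple 1 ((Real.pi : ℂ) - k) y 0 ∈
        Submodule.span ℤ (Set.range (latTriple 1 ((Real.pi : ℂ) - k) y)) :=
      Submodule.add_mem _ (Submodule.subset_span ⟨1, rfl⟩)
        (Submodule.smul_mem _ _ (Submodule.subset_span ⟨0, rfl⟩))
    have e : latTriple 1 ((Real.pi : ℂ) - k) y 1 + k • latTriple 1 ((Real.pi : ℂ) - k) y 0 =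
        (Real.pi : ℂ) := by
      simp only [latTriple_one, latTriple_zero, zsmul_eq_mul, mul_one]; ring
    rw [e] at hm
    exact hm
  have hθz : ∀ i, θπ i ∈ adjoin ℚ (SFset (latTriple 1 ((Real.pi : ℂ) - k) y) ∪ {I}) := by
    intro i
    match i with
    | 0 => exact cexp_mem_adjoin_of_mem_span hπ
    | 1 => exact mem_adjoin_of_mem_span hπ
  exact sb_of_hyperLat_of_mvWeakMeasure (n := 2) (mvWeakMeasure_θπ h52) hθz _ _ hy'
    (mem_adjoin_SFset_I' (Or.inl ⟨2, rfl⟩))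

/-! ### §7f  The member `z_π = (1, π − 3, y(π − 3))` — genuinely ternary, Nesterenko-anchored -/

/-- `ξ_π = π − 3 ∈ (0, 3/2]`. -/
def ξπ : ℝ := Real.pi - 3

/-- `ξ_π = π − 3` is positive. -/
theorem ξπ_pos : 0 < ξπ := by unfold ξπ; linarith [Real.pi_gt_three]

/-- `ξ_π = π − 3 ≤ 3/2`. -/
theorem ξπ_le : ξπ ≤ 3 / 2 := by unfold ξπ; linarith [Real.pi_lt_four]

/-- `(ξ_π : ℂ) = π − 3`. -/
theorem ξπ_cast : (ξπ : ℂ) = (Real.pi : ℂ) - ((3 : ℤ) : ℂ) := by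
  unfold ξπ; push_cast; ring

/-- **`z_π = (1, π − 3, y_π)`**, `y_π = Σ_k w_k 2^{−a_k}`, `w_k ∈ {1, π − 3}` alternating (the §5b series
`yx (π − 3)`). -/
def zπ : Fin 3 → ℂ := latTriple 1 (ξπ : ℂ) (yx ξπ : ℂ)

/-- `z_π = (1, π − 3, y(π − 3))` as a `latTriple`. -/
theorem zπ_eq : zπ = latTriple 1 ((Real.pi : ℂ) - ((3 : ℤ) : ℂ)) (yx ξπ : ℂ) := by
  rw [zπ, ξπ_cast]

/-- `y_π` is hyper-approximable from `(ℤ + ℤ(π − 3))/2^{a_K}` — UNCONDITIONAL. -/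
theorem hyperLatApprox_zπ : HyperLatApprox 1 (ξπ : ℂ) (yx ξπ : ℂ) := hyperLatApprox_yx ξπ_pos ξπ_le

/-- `z_π` is `HyperLinLiouville` — UNCONDITIONAL. -/
theorem hyperLinLiouville_zπ : HyperLinLiouville zπ := hyperLinLiouville_latTriple hyperLatApprox_zπ

/-- `z_π` carries the Nesterenko anchor: `span_ℤ(z_π) ∋ 1, π` — UNCONDITIONAL. -/
theorem hasPiIntAnchor_zπ : HasPiIntAnchor zπ := by
  refine ⟨1, one_ne_zero, ?_, ?_⟩
  · rw [Int.cast_one, show (1 : ℂ) = zπ 0 from rfl]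
    exact Submodule.subset_span ⟨0, rfl⟩
  · have e : (Real.pi : ℂ) = zπ 1 + (3 : ℤ) • zπ 0 := by
      rw [show zπ 1 = (ξπ : ℂ) from rfl, show zπ 0 = (1 : ℂ) from rfl, zsmul_eq_mul, ξπ_cast]
      push_cast; ring
    rw [e]
    exact Submodule.add_mem _ (Submodule.subset_span ⟨1, rfl⟩)
      (Submodule.smul_mem _ _ (Submodule.subset_span ⟨0, rfl⟩))

/-- **`z_π` has GENUINELY TERNARY small forms at every level** (all three coefficients non-zero) —
UNCONDITIONAL. -/
theorem ternarySmallForms_zπ (m : ℕ) :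
    ∃ h : Fin 3 → ℤ, (∀ i, h i ≠ 0) ∧
      ‖∑ i, (h i : ℂ) * zπ i‖ < Real.exp (-((1 + ∑ i, |(h i : ℝ)|) ^ m)) :=
  ternarySmallForms_yx ξπ_pos ξπ_le m

/-- `(y_π, e^{π}, π)` is algebraically independent (mod Cor. 5.2). -/
theorem algebraicIndependent_zπ (h52 : Literature.Barriers.Schanuel.NesterenkoPhilippon2001_ch3_cor_5_2) :
    AlgebraicIndependent ℚ (fun o : Option (Fin 2) => o.elim (yx ξπ : ℂ) θπ) :=
  algebraicIndependent_one_pi_sub h52 3 (ξπ_cast ▸ hyperLatApprox_zπ)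

/-- `z_π` is ℚ-free (mod Cor. 5.2). -/
theorem linearIndependent_zπ (h52 : Literature.Barriers.Schanuel.NesterenkoPhilippon2001_ch3_cor_5_2) :
    LinearIndependent ℚ zπ := by
  rw [zπ_eq]; exact linearIndependent_one_pi_sub h52 3 (ξπ_cast ▸ hyperLatApprox_zπ)

/-- `z_π` is ℚ-free (mod NW 1996 Thm 2(2) instead: the lattice route). -/
theorem linearIndependent_zπ' (hNW : Literature.NumberTheory.Transcendental.NesterenkoWaldschmidt1996_thm_2_2) :
    LinearIndependent ℚ zπ := by
  have hLB : LatLB 1 (ξπ : ℂ) := by rw [ξπ_cast]; exact (latLB_one_pi hNW).one_sub_int 3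
  exact linearIndependent_latTriple hLB hyperLatApprox_zπ

/-- **ONE ALGEBRAIC LINE IN `span_ℤ(z_π)` (mod Cor. 5.2)**: its algebraic elements are the integers. -/
theorem eq_intCast_of_isAlgebraic_mem_span_zπ
    (h52 : Literature.Barriers.Schanuel.NesterenkoPhilippon2001_ch3_cor_5_2) {v : ℂ}
    (hv : v ∈ Submodule.span ℤ (Set.range zπ)) (halg : IsAlgebraic ℚ v) : ∃ a : ℤ, v = a := by
  rw [zπ_eq] at hv
  exact eq_intCast_of_isAlgebraic_mem_span_one_pi_sub h52 3 (ξπ_cast ▸ hyperLatApprox_zπ) hv halg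

/-- `z_π` is OUTSIDE the g15 cell (mod Cor. 5.2). -/
theorem not_hasRealQuadAnchor_zπ (h52 : Literature.Barriers.Schanuel.NesterenkoPhilippon2001_ch3_cor_5_2) :
    ¬ HasRealQuadAnchor zπ :=
  not_hasRealQuadAnchor_of_span_int fun _ hv halg => eq_intCast_of_isAlgebraic_mem_span_zπ h52 hv halg

/-- **SCHANUEL'S BOUND FOR `z_π` (mod Cor. 5.2 ONLY): `trdeg ℚ(1, π − 3, y_π, e, e^{π−3}, e^{y_π}) ≥ 3`.** -/
theorem sb_three_zπ (h52 : Literature.Barriers.Schanuel.NesterenkoPhilippon2001_ch3_cor_5_2) : SB 3 zπ := by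
  rw [zπ_eq]; exact sb_three_latTriple_one_pi_sub h52 3 (ξπ_cast ▸ hyperLatApprox_zπ)

/-- **`z_π` instantiates the residual `Rank3SpanResidual` (mod Cor. 5.2)** — whatever the status of the
uncertified `¬HasHLPairInSpan z_π`, the residual's conclusion holds at `z_π`. -/
theorem rank3SpanResidual_instance_zπ
    (h52 : Literature.Barriers.Schanuel.NesterenkoPhilippon2001_ch3_cor_5_2) :
    LinearIndependent ℚ zπ → HyperLinLiouville zπ → ¬ HasHLPairInSpan zπ → SB 3 zπ :=
  fun _ _ _ => sb_three_zπ h52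

/-- **THE THREE-CELL CARVE: residual of record after g15 + addendum + §7** (mod LW, Cor. 5.2, NW Thm 2(2)).
`Rank3SpanResidual ↔ ∀ z, ℚ-free → HLL → ¬HasHLPairInSpan → ¬HasRealQuadAnchor → ¬HasExpLatAnchor →
¬HasPiIntAnchor → SB 3 z`. -/
theorem rank3SpanResidual_iff_unanchored₃ (hLW : LWMeasure)
    (h52 : Literature.Barriers.Schanuel.NesterenkoPhilippon2001_ch3_cor_5_2)
    (hNW : Literature.NumberTheory.Transcendental.NesterenkoWaldschmidt1996_thm_2_2) :
    Rank3SpanResidual ↔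
      ∀ z : Fin 3 → ℂ, LinearIndependent ℚ z → HyperLinLiouville z → ¬ HasHLPairInSpan z →
        ¬ HasRealQuadAnchor z → ¬ HasExpLatAnchor z → ¬ HasPiIntAnchor z → SB 3 z :=
  rank3SpanResidual_iff_of_cells₃ (fun _ hz hH hA => sb_three_of_realQuadAnchor hLW hz hH hA)
    (fun _ hz hH hA => sb_three_of_expLatAnchor hLW hz hH hA)
    (fun _ hz hH hA => sb_three_of_piIntAnchor h52 hNW hz hH hA)

/-- **PLACEMENT OF `z_π`**: residual hypotheses ℚ-free (mod Cor. 5.2) and HLL (unconditional), INSIDE the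
new cell (unconditional), OUTSIDE the g15 cell (mod Cor. 5.2), Schanuel's bound (mod Cor. 5.2).  NOT
certified here: `¬HasHLPairInSpan z_π` (a real member: needs the g15 §6–§7 Lemma-P machinery at the
scale of `π`'s irrationality measure) and `¬HasExpLatAnchor z_π` (would need the algebraic independence
of `π` and `e^{α}`, OPEN). -/
theorem placement_zπ (h52 : Literature.Barriers.Schanuel.NesterenkoPhilippon2001_ch3_cor_5_2) :
    LinearIndependent ℚ zπ ∧ HyperLinLiouville zπ ∧ HasPiIntAnchor zπ ∧ ¬ HasRealQuadAnchor zπ ∧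
      SB 3 zπ :=
  ⟨linearIndependent_zπ h52, hyperLinLiouville_zπ, hasPiIntAnchor_zπ, not_hasRealQuadAnchor_zπ h52,
    sb_three_zπ h52⟩

end LatCell

end HyperCell

end Summit.Schanuel.Schanuel.Theorems.RootDecomp1KHyper
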